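import Summits.ResolutionOfSingularities.ResolutionOfSingularities.Theorems.MarkedTransferCampaignW46ForcedRegime
import Summits.ResolutionOfSingularities.ResolutionOfSingularities.Theorems.MarkedTransferCampaignW46PlaneIsolated
import Summits.ResolutionOfSingularities.ResolutionOfSingularities.Theorems.MarkedTransferCampaignW46LiteralCentreProcrastination
import Summits.ResolutionOfSingularities.ResolutionOfSingularities.Theorems.WildConesCampaignW46StalkChart
import Summits.ResolutionOfSingularities.ResolutionOfSingularities.Theorems.WildConesCampaignW46RationalPoint
import Summits.ResolutionOfSingularities.ResolutionOfSingularities.Theorems.WildConesCampaignW46TransformStalk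
import Summits.ResolutionOfSingularities.ResolutionOfSingularities.Theorems.WildConesCampaignW46RsopAdapted
import Summits.ResolutionOfSingularities.ResolutionOfSingularities.Theorems.WildConesCampaignW46ChartReindex
import Summits.ResolutionOfSingularities.ResolutionOfSingularities.Theorems.WildConesCampaignW46ThreefoldsCharTwoSplittingRegime
import Summits.ResolutionOfSingularities.ResolutionOfSingularities.Theorems.WildConesIsolatedForcedTermination
import Literature.AlgebraicGeometry.Resolution.GenericPointStalkData
import HarnessLib

/-!
# [OURS · L1 W4.6, rung (i)/(all `n`) — the TYPED Th. 16.6 procedure TERMINATES in the forced-atom regime]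
# (cell res-hironaka, LADDER-RESOLUTION rung L, D-0089; slot W4.6, seat res-L1-s46-pv-2 gen 2; host route
# `WildCones`, crux `ClassicalRegimes` stmt-ResolutionOfSingularities-16884, `--supports … --as helper`)

HONEST FRAMING. Everything here is OURS. NOTHING below is a statement of H. Hironaka's manuscript *Resolution of
singularities in positive characteristics* (2017-03-23, [Hironaka2017]) and nothing asserts that any statement of it
holds: the typed Th. 16.6 procedure (`CampaignW46.Run`, `Terminates`, `Regime`, typed by res-L1-type-o1 in
`Theorems/MarkedTransferCampaignW46TypedProcedure.lean`) enters as a DEFINITION, the typed candidate carriers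
(`IdealExponent`, `.sing`, `.transform`, `AmbientDatum`) as definitions, and the résumés' Def. 15.12 inclusions only
through the landed anchor `IsCentre.subset_sing`. No FACT-LIST premise is used. AI review is weaker than expert review.

## What is proved (the assembly of this seat's dictionary, bricks 1–12)

**`CampaignW46.terminates_of_le_forcedAtom`.** Fix a prime `p`, an algebraically closed field `K` of characteristic
`p` (universe `0`, forced by the coefficient calculus of route `WildCones`), `0 < n`, a notion instance `N` and a
reading `Rd`. Let `Rg` be ANY regime of the typed procedure contained in the FORCED-ATOM class: at a state `(A, E)`
in `Rg`, `E = (J, p)`, `Sing(E)` has at most one point, and at every `ξ ∈ Sing(E)` the local ring `𝒪_{Z,ξ}` has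
embedding dimension `n + 1`, its completion admits SOME presentation `E₀ : 𝒪̂_{Z,ξ} ≅ K⟦z,u₁,…,uₙ⟧` (a ring
isomorphism) carrying a generator `f₀` of `J_ξ` to a unit times a height-one atom `z^p − a(u)` (`a = ser c₀` a cleaned
coefficient function of the `WildCones` calculus), and EVERY such presentation has `Isol(c₀)` (finite Milnor algebra
`K⟦u⟧/(∂a)`). THEN `Terminates N Rd Rg`: the typed procedure admits no infinite run inside `Rg`.

Proof (this file, one step + an induction): in the forced class the centre of every step is the singular point
(pv-4's `Run.exists_centres_eq_singleton`); at the next singular point `ξ′` (closed: it is the next centre) the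
dictionary applies — an adapted regular system of parameters exists (`exists_rsop_adapted`, Nakayama), `ξ′` is
`K`-rational relative to `π` (brick 7′), the blow-up has Rees chart data at `ξ′` with a non-zero-divisor exceptional
parameter (brick 6″), the `z`-chart point is never singular (brick 9) so after re-indexing (brick 10) the chart is a
`u`-chart, the controlled transform is principal at `ξ′` (brick 12) and its completion is a unit times the SUCCESSOR
atom `z^p − ser (step i₀ τ c₀)` of the `WildCones` dynamics (brick 8); multiplicity `p` is read through the completion
(brick 9), isolatedness is the regime's clause. An infinite run in `Rg` would therefore produce an infinite isolated
multiplicity-`p` run of the point-blow-up dynamics of a height-one atom over the perfect field `K` — excluded for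
every `n ≥ 1` by the PROVED target of routes `FrobeniusClosing`/`WildCones`
(`WildCones.IsolatedForcedTermination_proof`, stmt-ResolutionOfSingularities-16343).

The regime is taken in antitone form (`hRg : Rg ≤ forced-atom class`), so the theorem is definition-free; a named
regime `Regime.forcedAtom p K n` with exactly this body (typer's word) yields `Terminates N Rd (Regime.forcedAtom p K n)`
by `terminates_of_le_forcedAtom … (fun _ _ h => h)`. The clause «EVERY presentation is isolated» is, by the folklore
invariance of the Tjurina number under formal coordinate change and units (brick 11/11b,
`finite_tjurina_iff_of_algEquiv_option`, for `K`-algebra coordinate changes), the same as asking it of one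
presentation; it is stated for all so that no coordinate comparison is needed along the run. The case `n = 0`
(curves) is excluded: there the atom `z^p` has no multiplicity-`p` successor and the calculus' `MultP` is empty.

References: this seat's bricks 1–12 (`Theorems/WildConesCampaignW46*.lean`); pv-4 `…W46ForcedRegime.lean`; pv-1
`…W46PlaneIsolated.lean` (`sing_subset_of_transform`); `…W46LiteralCentreProcrastination.lean` (`ambient_isRegular`).
[cite: Matsumura1987, Thm. 8.11] for completions and quotients; [cite: StacksProject, Tag 0804] for blow-up charts.
-/

noncomputable section

-- single-problem summit: the doubled namespace component `ResolutionOfSingularities` is forced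
set_option linter.dupNamespace false

open scoped BigOperators Classical
open MvPowerSeries IsLocalRing

namespace Summit.ResolutionOfSingularities.ResolutionOfSingularities.Theorems

/-! ## Scheme level: one step of a run in the forced-atom class -/

namespace CampaignW46.ForcedAtom

open CategoryTheory AlgebraicGeometry TopologicalSpace
open Literature.AlgebraicGeometry.Resolution
open Literature.AlgebraicGeometry.Hironaka2017.S02Preliminaries
open Scheme.IdealSheafData
open WildCones
open CampaignW46.ChartPoint CampaignW46.AtomGerm CampaignW46.FormalChart

variable {p : ℕ} [Fact p.Prime] {K : Type} [Field K] [CharP K p] [IsAlgClosed K] {n : ℕ}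

/-- [OURS · L1 W4.6 — the ONE STEP of the typed procedure in the forced-atom class; replaces the role of «the
transform `E′` of `E` by the blowup with center `D`» (H. Hironaka, ms. 2017, Th. 16.6 p.84 / Def. 2.1 p.5) at an
isolated `p`-fold point presented by a height-one atom; NOT a statement of the manuscript] Let `s` be a step of the
typed procedure from `(A, E)` with `E = (J, p)` and `Sing(E)` a single point `ξ` of embedding dimension `n + 1`,
and let `(E₀, f₀, a, w)` present `J_ξ` as a unit times the atom `z^p − ser a` with `MultP a`. Then at every CLOSED
point `ξ′ ∈ Sing(E′)` of the transform, `J′_{ξ′}` is presented by a unit times the SUCCESSOR atom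
`z^p − ser (step i₀ t a)` for some chart index `i₀` and translation `t` of the `WildCones` dynamics. [folklore] -/
theorem exists_presentation_transform {m : ℕ} {N : Notions.{0} m} {A A' : AmbientDatum p K}
    {E : IdealExponent A.Z} {R : Resume N A E} (s : Step R A') (hb : E.b = p) (hS : E.sing.Subsingleton)
    {ξ : A.Z} (hξ : ξ ∈ E.sing) (hd : (maximalIdeal (A.Z.presheaf.stalk ξ)).spanFinrank = n + 1)
    (E₀ : AdicCompletion (maximalIdeal (A.Z.presheaf.stalk ξ)) (A.Z.presheaf.stalk ξ) ≃+*
      MvPowerSeries (Option (Fin n)) K)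
    (f₀ : A.Z.presheaf.stalk ξ) (a : (Fin n → ℕ) → K) (w : MvPowerSeries (Option (Fin n)) K)
    (hJ : stalkIdeal E.J ξ = Ideal.span {f₀}) (hw : IsUnit w)
    (hf₀ : E₀ (algebraMap _ _ f₀) =
      w * ((X none : MvPowerSeries (Option (Fin n)) K) ^ p - rename (some : Fin n → Option (Fin n)) (ser p n K a)))
    (hM : MultP p n K a)
    {ξ' : A'.Z} (hξ' : ξ' ∈ s.E'.sing) (hξ'cl : IsClosed ({ξ'} : Set A'.Z)) :
    ∃ (i₀ : Fin n) (t : Fin n → K)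
      (E₀' : AdicCompletion (maximalIdeal (A'.Z.presheaf.stalk ξ')) (A'.Z.presheaf.stalk ξ') ≃+*
        MvPowerSeries (Option (Fin n)) K)
      (f₀' : A'.Z.presheaf.stalk ξ') (w' : MvPowerSeries (Option (Fin n)) K),
      stalkIdeal s.E'.J ξ' = Ideal.span {f₀'} ∧ IsUnit w' ∧
        E₀' (algebraMap _ _ f₀') =
          w' * ((X none : MvPowerSeries (Option (Fin n)) K) ^ p -
            rename (some : Fin n → Option (Fin n)) (ser p n K (step p n K i₀ t a))) := by
  haveI : IsLocallyNoetherian A'.Z := ambient_isLocallyNoetherian A'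
  have hp : p.Prime := Fact.out
  -- the centre is the singular point, and `ξ′` lies over it
  have hD : (s.D : Set A.Z) = {ξ} := by
    obtain ⟨ξ₁, hD₁, hS₁⟩ := s.centre.exists_coe_eq_singleton hS
    have h1 : ξ = ξ₁ := by
      have h2 := hξ
      rw [hS₁] at h2
      exact h2
    subst h1
    exact hD₁
  have hπξ : s.π ξ' = ξ :=
    hS (sing_subset_of_transform s.blowup E s.centre.subset_sing (show ξ' ∈ (E.transform s.π s.D).sing from hξ')) hξ
  subst hπξ
  haveI : IsRegularLocalRing (A.Z.presheaf.stalk (s.π ξ')) := ambient_isRegular A _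
  haveI : IsRegularLocalRing (A'.Z.presheaf.stalk ξ') := ambient_isRegular A' _
  -- the local homomorphism `g = π^♯_{ξ′}`
  have hloc : IsLocalHom (s.π.stalkMap ξ').hom := inferInstance
  have hg : (maximalIdeal (A.Z.presheaf.stalk (s.π ξ'))).map (s.π.stalkMap ξ').hom ≤
      maximalIdeal (A'.Z.presheaf.stalk ξ') :=
    ((IsLocalRing.local_hom_TFAE (s.π.stalkMap ξ').hom).out 0 2).mp hloc
  -- an adapted regular system of parameters at `π ξ′`
  obtain ⟨c, hc, hcX⟩ := exists_rsop_adapted E₀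
  have hcl : IsClosed ({s.π ξ'} : Set A.Z) := hD ▸ s.D.isClosed
  have hcJ : Ideal.span (Set.range c) = stalkIdeal (vanishingIdeal s.D) (s.π ξ') := by
    rw [hc, stalkIdeal_vanishingIdeal_eq_maximalIdeal_of_closure_eq]
    rw [hD, hcl.closure_eq]
  -- `ξ′` is rational relative to `π`
  haveI : LocallyOfFiniteType (s.π ≫ A.hom) := by
    rw [← s.hom_eq]
    haveI := A'.smooth
    infer_instance
  have hrat : ∀ y : A'.Z.presheaf.stalk ξ', ∃ r : A.Z.presheaf.stalk (s.π ξ'),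
      y - (s.π.stalkMap ξ').hom r ∈ maximalIdeal (A'.Z.presheaf.stalk ξ') := fun y =>
    exists_sub_stalkMap_mem_maximalIdeal_of_isClosed s.π A.hom ξ' hξ'cl y
  -- chart data of the blow-up at `ξ′`
  have hd' : (maximalIdeal (A.Z.presheaf.stalk (s.π ξ'))).spanFinrank = Fintype.card (Option (Fin n)) := by
    rw [hd, Fintype.card_option, Fintype.card_fin]
  obtain ⟨i, e, τ, he, hei, hnzd, hgen, -, hdim⟩ := exists_stalk_chartData_nzd s.blowup ξ' c hcJ hc hd' hrat
  -- `f₀ ∈ 𝔪^p`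
  have hf₀𝔪 : f₀ ∈ maximalIdeal (A.Z.presheaf.stalk (s.π ξ')) ^ p := by
    have h := hξ
    change (E.b : ℕ∞) ≤ idealOrder E.J _ at h
    rw [le_idealOrder_iff, hJ, Ideal.span_singleton_le_iff_mem, hb] at h
    exact h
  -- the conclusion from chart data with a `u`-index
  have tail : ∀ (i₀ : Fin n) (e : Option (Fin n) → A'.Z.presheaf.stalk ξ')
      (τ : Option (Fin n) → A.Z.presheaf.stalk (s.π ξ')),
      (∀ j, (s.π.stalkMap ξ').hom (c j) = (s.π.stalkMap ξ').hom (c (some i₀)) * e j) →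
      (s.π.stalkMap ξ').hom (c (some i₀)) ∈ nonZeroDivisors (A'.Z.presheaf.stalk ξ') →
      Ideal.span (Set.range fun j : Option (Fin n) => if j = some i₀ then (s.π.stalkMap ξ').hom (c (some i₀))
        else e j - (s.π.stalkMap ξ').hom (τ j)) = maximalIdeal (A'.Z.presheaf.stalk ξ') →
      ∃ (i₀ : Fin n) (t : Fin n → K)
        (E₀' : AdicCompletion (maximalIdeal (A'.Z.presheaf.stalk ξ')) (A'.Z.presheaf.stalk ξ') ≃+*
          MvPowerSeries (Option (Fin n)) K)
        (f₀' : A'.Z.presheaf.stalk ξ') (w' : MvPowerSeries (Option (Fin n)) K),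
        stalkIdeal s.E'.J ξ' = Ideal.span {f₀'} ∧ IsUnit w' ∧
          E₀' (algebraMap _ _ f₀') =
            w' * ((X none : MvPowerSeries (Option (Fin n)) K) ^ p -
              rename (some : Fin n → Option (Fin n)) (ser p n K (step p n K i₀ t a))) := by
    intro i₀ e τ he hnzd hgen
    obtain ⟨f', hf'⟩ := exists_eq_pow_mul_of_mem_pow (s.π.stalkMap ξ').hom c hc (some i₀) e he hf₀𝔪
    have hJ' : stalkIdeal s.E'.J ξ' = Ideal.span {f'} :=
      stalkIdeal_transform_eq_span s.blowup ξ' c hcJ (some i₀) e he hnzd E f₀ hJ f' (by rw [hb]; exact hf')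
    have hf'𝔪 : f' ∈ maximalIdeal (A'.Z.presheaf.stalk ξ') := by
      have h := (mem_sing_transform_iff E ξ' f' hJ').mp hξ'
      rw [hb] at h
      exact Ideal.pow_le_self hp.ne_zero h
    obtain ⟨E', w', hw', -, hE'⟩ := exists_ringEquiv_transform_atom (s.π.stalkMap ξ').hom hg E₀ c hc hcX i₀ e he τ
      hgen hrat hdim a hM f₀ w hw hf₀ f' hf' hf'𝔪
    exact ⟨i₀, _, E', f', w', hJ', hw', hE'⟩
  -- case on the chart index
  cases i with
  | some i₀ => exact tail i₀ e τ he hnzd hgen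
  | none =>
    obtain ⟨f', hf'⟩ := exists_eq_pow_mul_of_mem_pow (s.π.stalkMap ξ').hom c hc none e he hf₀𝔪
    have hJ' : stalkIdeal s.E'.J ξ' = Ideal.span {f'} :=
      stalkIdeal_transform_eq_span s.blowup ξ' c hcJ none e he hnzd E f₀ hJ f' (by rw [hb]; exact hf')
    have hf'𝔪 : f' ∈ maximalIdeal (A'.Z.presheaf.stalk ξ') := by
      have h := (mem_sing_transform_iff E ξ' f' hJ').mp hξ'
      rw [hb] at h
      exact Ideal.pow_le_self hp.ne_zero h
    -- the `z`-chart point is not singular: some `τ̃_{j₀}` is a unit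
    by_cases hτ : ∀ j : Fin n, τ (some j) ∈ maximalIdeal (A.Z.presheaf.stalk (s.π ξ'))
    · exact absurd hf'𝔪 (not_mem_maximalIdeal_transform_of_zChart (s.π.stalkMap ξ').hom hg E₀ c hc hcX e he τ
        hgen hrat hdim hτ a hM f₀ w hw hf₀ f' hf')
    · simp only [not_forall] at hτ
      obtain ⟨j₀, hj₀⟩ := hτ
      have hu : IsUnit (τ (some j₀)) := (IsLocalRing.notMem_maximalIdeal).mp hj₀
      obtain ⟨e', τ', he', -, hgen'⟩ := exists_chartData_reindex (s.π.stalkMap ξ').hom c none e he hei τ hgen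
        (some j₀) (Option.some_ne_none j₀) hu
      -- the new exceptional parameter is a non-zero-divisor: `g c_{j₀} = g c_none · e_{j₀}` with `e_{j₀}` a unit
      have hej₀ : IsUnit (e (some j₀)) := by
        refine isUnit_of_sub_mem_maximalIdeal (hu.map (s.π.stalkMap ξ').hom) ?_
        rw [← hgen]
        exact Ideal.subset_span ⟨some j₀, by dsimp only; rw [if_neg (Option.some_ne_none j₀)]⟩
      have hnzd' : (s.π.stalkMap ξ').hom (c (some j₀)) ∈ nonZeroDivisors (A'.Z.presheaf.stalk ξ') := by
        rw [he (some j₀)]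
        exact mul_mem hnzd hej₀.mem_nonZeroDivisors
      exact tail j₀ e' τ' he' hnzd' hgen'

/-! ## The rung: the typed procedure has no infinite run in the forced-atom class -/

/-- [OURS · L1 W4.6, rung (i) for surfaces (`n = 1`), (ii)-type for all `n ≥ 1`; replaces the role of the termination
clause of Th. 16.13 p.87 l.26–28 («repeatedly but finitely many times») of H. Hironaka's ms. (2017) for the TYPED
Th. 16.6 procedure restricted to the forced-atom class; NOT a statement of the manuscript] **The typed procedure
terminates in every regime contained in the forced-atom class.** See the module docstring for the class and the proof.
The conclusion is `CampaignW46.Terminates` (no infinite `Run`; a fortiori `TerminatesNabla`). [folklore] -/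
theorem terminates_of_le_forcedAtom (hn : 0 < n) {m : ℕ} (N : Notions.{0} m) (Rd : Reading p K N) (Rg : Regime p K)
    (hRg : ∀ (A : AmbientDatum p K) (E : IdealExponent A.Z), Rg A E →
      E.b = p ∧ E.sing.Subsingleton ∧ ∀ ξ ∈ E.sing,
        (maximalIdeal (A.Z.presheaf.stalk ξ)).spanFinrank = n + 1 ∧
        (∃ (E₀ : AdicCompletion (maximalIdeal (A.Z.presheaf.stalk ξ)) (A.Z.presheaf.stalk ξ) ≃+*
            MvPowerSeries (Option (Fin n)) K)
          (f₀ : A.Z.presheaf.stalk ξ) (c₀ : (Fin n → ℕ) → K) (w₀ : MvPowerSeries (Option (Fin n)) K),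
          stalkIdeal E.J ξ = Ideal.span {f₀} ∧ IsUnit w₀ ∧
            E₀ (algebraMap _ _ f₀) = w₀ * ((X none : MvPowerSeries (Option (Fin n)) K) ^ p -
              rename (some : Fin n → Option (Fin n)) (ser p n K c₀))) ∧
        (∀ (E₀ : AdicCompletion (maximalIdeal (A.Z.presheaf.stalk ξ)) (A.Z.presheaf.stalk ξ) ≃+*
            MvPowerSeries (Option (Fin n)) K)
          (f₀ : A.Z.presheaf.stalk ξ) (c₀ : (Fin n → ℕ) → K) (w₀ : MvPowerSeries (Option (Fin n)) K),
          stalkIdeal E.J ξ = Ideal.span {f₀} → IsUnit w₀ →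
            E₀ (algebraMap _ _ f₀) = w₀ * ((X none : MvPowerSeries (Option (Fin n)) K) ^ p -
              rename (some : Fin n → Option (Fin n)) (ser p n K c₀)) → Isol p n K c₀)) :
    Terminates N Rd Rg := by
  intro r hr
  have hp : p.Prime := Fact.out
  have hreg := fun k => hRg _ _ (hr k)
  have hS : ∀ k, (r.E k).sing.Subsingleton := fun k => (hreg k).2.1
  obtain ⟨ξ, hξ⟩ := r.exists_centres_eq_singleton hS
  have hξS : ∀ k, ξ k ∈ (r.E k).sing := fun k => by
    rw [(hξ k).2]
    exact Set.mem_singleton _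
  have hcl : ∀ k, IsClosed ({ξ k} : Set (r.A k).Z) := fun k => by
    rw [← (hξ k).1]
    exact (r.step k).D.isClosed
  -- multiplicity `p` of a presented atom is read off `ξ_k ∈ Sing(E_k)` (and `ser ≠ 0` off isolatedness)
  have hmult : ∀ (k : ℕ)
      (E₀ : AdicCompletion (maximalIdeal ((r.A k).Z.presheaf.stalk (ξ k))) ((r.A k).Z.presheaf.stalk (ξ k)) ≃+*
        MvPowerSeries (Option (Fin n)) K)
      (f₀ : (r.A k).Z.presheaf.stalk (ξ k)) (a : (Fin n → ℕ) → K) (w : MvPowerSeries (Option (Fin n)) K),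
      stalkIdeal (r.E k).J (ξ k) = Ideal.span {f₀} → IsUnit w →
        E₀ (algebraMap _ _ f₀) = w * ((X none : MvPowerSeries (Option (Fin n)) K) ^ p -
          rename (some : Fin n → Option (Fin n)) (ser p n K a)) → MultP p n K a := by
    intro k E₀ f₀ a w hJ hw hf₀
    haveI : IsRegularLocalRing ((r.A k).Z.presheaf.stalk (ξ k)) := ambient_isRegular (r.A k) _
    have hI : Isol p n K a := ((hreg k).2.2 (ξ k) (hξS k)).2.2 E₀ f₀ a w hJ hw hf₀
    have hf₀𝔪 : f₀ ∈ maximalIdeal ((r.A k).Z.presheaf.stalk (ξ k)) ^ p := by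
      have h := hξS k
      change ((r.E k).b : ℕ∞) ≤ idealOrder (r.E k).J _ at h
      rw [le_idealOrder_iff, hJ, Ideal.span_singleton_le_iff_mem, (hreg k).1] at h
      exact h
    exact (transform_mem_pow_iff_multP E₀ hw a hf₀).2.mpr ⟨ThreefoldsCharTwo.ser_ne_zero_of_isol hn hI, hf₀𝔪⟩
  -- presentations at `ξ_k`, and the one-step transition
  let P : ℕ → Type := fun k =>
    Σ' (E₀ : AdicCompletion (maximalIdeal ((r.A k).Z.presheaf.stalk (ξ k))) ((r.A k).Z.presheaf.stalk (ξ k)) ≃+*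
        MvPowerSeries (Option (Fin n)) K)
      (f₀ : (r.A k).Z.presheaf.stalk (ξ k)) (a : (Fin n → ℕ) → K) (w : MvPowerSeries (Option (Fin n)) K),
      stalkIdeal (r.E k).J (ξ k) = Ideal.span {f₀} ∧ IsUnit w ∧
        E₀ (algebraMap _ _ f₀) = w * ((X none : MvPowerSeries (Option (Fin n)) K) ^ p -
          rename (some : Fin n → Option (Fin n)) (ser p n K a))
  have hnext : ∀ (k : ℕ) (q : P k), ∃ (i₀ : Fin n) (t : Fin n → K) (q' : P (k + 1)),
      q'.2.2.1 = step p n K i₀ t q.2.2.1 := by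
    intro k q
    obtain ⟨E₀, f₀, a, w, hJ, hw, hf₀⟩ := q
    have hd := ((hreg k).2.2 (ξ k) (hξS k)).1
    have hξ' : ξ (k + 1) ∈ (r.step k).E'.sing := by
      rw [← r.E_succ k]
      exact hξS (k + 1)
    obtain ⟨i₀, t, E₀', f₀', w', hJ', hw', hf₀'⟩ := exists_presentation_transform (r.step k) (hreg k).1 (hS k)
      (hξS k) hd E₀ f₀ a w hJ hw hf₀ (hmult k E₀ f₀ a w hJ hw hf₀) hξ' (hcl (k + 1))
    refine ⟨i₀, t, ⟨E₀', f₀', step p n K i₀ t a, w', ?_, hw', hf₀'⟩, rfl⟩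
    rw [r.E_succ k]
    exact hJ'
  choose inext tnext qnext hnext using hnext
  -- the initial presentation and the induced sequence of presentations
  obtain ⟨E₀, f₀, c₀, w₀, hJ0, hw0, hf0⟩ := ((hreg 0).2.2 (ξ 0) (hξS 0)).2.1
  let q0 : P 0 := ⟨E₀, f₀, c₀, w₀, hJ0, hw0, hf0⟩
  let sq : ∀ k, P k := fun k => Nat.rec (motive := fun k => P k) q0 (fun k q => qnext k q) k
  have hsq : ∀ k, sq (k + 1) = qnext k (sq k) := fun k => rfl
  -- the induced run of the coefficient calculus
  have hrun : ∀ k, run p n K c₀ (fun k => inext k (sq k)) (fun k => tnext k (sq k)) k = (sq k).2.2.1 := by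
    intro k
    induction k with
    | zero => rfl
    | succ k ih =>
      rw [hsq, hnext k (sq k), ← ih]
      rfl
  -- every state is isolated of multiplicity `p`: contradiction with the proved target of `WildCones`
  have hnot : ¬ InfRun p n K c₀ (fun k => inext k (sq k)) (fun k => tnext k (sq k)) :=
    IsolatedForcedTermination_proof p hp n hn K c₀ _ _
  refine hnot fun k => ?_
  rw [hrun k]
  obtain ⟨E₀, f₀, a, w, hJ, hw, hf₀⟩ := sq k
  exact ⟨((hreg k).2.2 (ξ k) (hξS k)).2.2 E₀ f₀ a w hJ hw hf₀, hmult k E₀ f₀ a w hJ hw hf₀⟩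

end CampaignW46.ForcedAtom

end Summit.ResolutionOfSingularities.ResolutionOfSingularities.Theorems

end
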